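import Summits.AtomisticToContinuum.HydrodynamicLimit.Theorems.LocalSecondLaw.Negative.LinearMajorant
import Summits.AtomisticToContinuum.HydrodynamicLimit.Theorems.JParityClosureOddContactSymmetryGibbsInvariance

/-!
# The weighted time integral of `Dev` along the flow, in expectation: Tonelli + flow-invariance

Tightness programme, step C, for the crux `JParityClosure.LocalSecondLaw` (stmt-AtomisticToContinuum-13081;
standing disprover's `Cruxes/LocalSecondLaw/Disproof.lean`).  `flowReg Φ (z,s)` — the flow on `Φ.good`, the
identity off it — is JOINTLY measurable on `Config × ℝ` (`measurable_flowReg`: `Measurable.dite` over the tree's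
`HardSphereFlow.measurable_flow_prod_torus`), so for `ψ` with continuous `ψ' ≤ 0` the functional
`z ↦ ∫₀¹ (-ψ'(s)) Dev(Φₛ z) ds` is a.e.-measurable under the local Gibbs law (`aemeasurable_timeIntegral_Dev`) and,
under the HOMOGENEOUS law, `E_N[∫₀¹ (-ψ') Dev(Φₛ ·) ds] = (ψ 0 - ψ 1) · E_N[Dev]`
(`lintegral_timeIntegral_Dev_eq`: Tonelli over `(z,s)`, then at each fixed `s` the sibling seat's flow-invariance
`Theorems.lintegral_comp_flow_localGibbsLaw_const`, then the fundamental theorem of calculus).  refuter-cdisprove-stmt-AtomisticToContinuum-13081-0.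
-/

noncomputable section

namespace Summit.AtomisticToContinuum.HydrodynamicLimit.Theorems.LocalSecondLawNegative

open MeasureTheory Filter Set Topology
open scoped ENNReal
open Literature.MathematicalPhysics.KineticTheory Literature.Analysis.FluidPDE

variable {N : ℕ}

/-- The right-hand side of the pathwise deviation bound is integrable on `[0,1]` for `z ∈ Φ.good`. [folklore] -/
theorem integrableOn_weight_Dev {σ r : ℝ} (hr : 0 < r) (hr2 : r < 1 / 2)
    (Φ : HardSphereFlow (Torus.geometry (Fin 3)) (hsDiameter σ N) (N + 1))
    {ψ : ℝ → ℝ} (hψc : Continuous (deriv ψ))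
    {z : Config (N + 1) (Fin 3) T3} (hz : z ∈ Φ.good) :
    IntegrableOn (fun s => -deriv ψ s * Dev r (Φ.flow s z)) (Set.Icc (0 : ℝ) 1) := by
  obtain ⟨M, hM⟩ := isCompact_Icc.exists_bound_of_continuousOn
    (hψc.continuousOn : ContinuousOn (deriv ψ) (Set.Icc (0 : ℝ) 1))
  have hmeasD : Measurable fun s => Dev r (Φ.flow s z) :=
    (continuous_Dev r).measurable.comp (measurable_flow_section Φ hz)
  haveI : IsFiniteMeasure ((volume : Measure ℝ).restrict (Set.Icc (0 : ℝ) 1)) :=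
    ⟨by rw [Measure.restrict_apply_univ]; exact measure_Icc_lt_top⟩
  refine Integrable.mono' (integrable_const (M * (4 * ke z + 14)))
    ((hψc.measurable.neg.mul hmeasD).aestronglyMeasurable) ?_
  refine ae_restrict_of_forall_mem measurableSet_Icc fun s hs => ?_
  have h1 : |deriv ψ s| ≤ M := by simpa [Real.norm_eq_abs] using hM s hs
  have h2 : Dev r (Φ.flow s z) ≤ 4 * ke z + 14 := by
    rw [← ke_flow_eq Φ hz s]; exact Dev_le hr hr2 _
  have h3 := Dev_nonneg r (Φ.flow s z)
  rw [Real.norm_eq_abs, abs_mul, abs_neg, abs_of_nonneg h3]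
  exact mul_le_mul h1 h2 h3 ((abs_nonneg _).trans h1)

/-- The measurable modification of the flow on `Config × ℝ`: the flow on `Φ.good`, the identity off it. [folklore] -/
def flowReg {σ : ℝ} (Φ : HardSphereFlow (Torus.geometry (Fin 3)) (hsDiameter σ N) (N + 1))
    (p : Config (N + 1) (Fin 3) T3 × ℝ) : Config (N + 1) (Fin 3) T3 :=
  haveI := Classical.dec (p.1 ∈ Φ.good)
  if p.1 ∈ Φ.good then Φ.flow p.2 p.1 else p.1

/-- On the good set the modification is the flow. [folklore] -/
theorem flowReg_of_mem {σ : ℝ} (Φ : HardSphereFlow (Torus.geometry (Fin 3)) (hsDiameter σ N) (N + 1))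
    {z : Config (N + 1) (Fin 3) T3} (hz : z ∈ Φ.good) (s : ℝ) : flowReg Φ (z, s) = Φ.flow s z := by
  simp [flowReg, hz]

/-- **The modification is jointly measurable** (`Measurable.dite` on `good × ℝ` with the tree's
`HardSphereFlow.measurable_flow_prod_torus`). [folklore] -/
theorem measurable_flowReg {σ : ℝ}
    (Φ : HardSphereFlow (Torus.geometry (Fin 3)) (hsDiameter σ N) (N + 1)) :
    Measurable (flowReg Φ) := by
  classical
  have hs : MeasurableSet {p : Config (N + 1) (Fin 3) T3 × ℝ | p.1 ∈ Φ.good} :=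
    measurable_fst Φ.measurableSet_good
  have hf : Measurable fun q : {p : Config (N + 1) (Fin 3) T3 × ℝ // p.1 ∈ Φ.good} =>
      Φ.flow q.1.2 q.1.1 := by
    have h1 := Φ.measurable_flow_prod_torus
    have h2 : Measurable fun q : {p : Config (N + 1) (Fin 3) T3 × ℝ // p.1 ∈ Φ.good} =>
        ((⟨q.1.1, q.2⟩ : Φ.good), q.1.2) :=
      (measurable_subtype_coe.fst.subtype_mk).prodMk measurable_subtype_coe.snd
    exact h1.comp h2
  have hg : Measurable fun q : {p : Config (N + 1) (Fin 3) T3 × ℝ // p ∈ {p : Config (N + 1) (Fin 3) T3 × ℝ | p.1 ∈ Φ.good}ᶜ} =>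
      q.1.1 := measurable_subtype_coe.fst
  have h := Measurable.dite (s := {p : Config (N + 1) (Fin 3) T3 × ℝ | p.1 ∈ Φ.good}) hf hg hs
  have heq : flowReg Φ = fun p : Config (N + 1) (Fin 3) T3 × ℝ =>
      if hx : p ∈ {p : Config (N + 1) (Fin 3) T3 × ℝ | p.1 ∈ Φ.good} then Φ.flow p.2 p.1 else p.1 := by
    funext p
    by_cases hp : p.1 ∈ Φ.good
    · simp [flowReg, hp]
    · simp [flowReg, hp]
  rw [heq]
  exact h

/-- **The expected weighted time integral of `Dev` along the flow equals `(ψ 0 - ψ 1) · E[Dev]`**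
(Tonelli over `(z, s)` through the measurable modification, then flow-invariance of the homogeneous
local Gibbs law at each fixed `s`, `Theorems.lintegral_comp_flow_localGibbsLaw_const`). [folklore] -/
theorem lintegral_timeIntegral_Dev_eq {σ r : ℝ} (hr : 0 < r) (hr2 : r < 1 / 2) (hσ : σ ≤ 1 / 2) (N : ℕ)
    (Φ : HardSphereFlow (Torus.geometry (Fin 3)) (hsDiameter σ N) (N + 1))
    {ψ : ℝ → ℝ} (hψd : Differentiable ℝ ψ) (hψc : Continuous (deriv ψ)) (hanti : Antitone ψ) :
    ∫⁻ z, ENNReal.ofReal (∫ s in Set.Icc (0 : ℝ) 1, -deriv ψ s * Dev r (Φ.flow s z))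
        ∂(localGibbsLaw σ (fun _ => 1) (fun _ => 0) (fun _ => 1) N Φ) =
      ENNReal.ofReal (ψ 0 - ψ 1) *
        ∫⁻ w, ENNReal.ofReal (Dev r w) ∂(localGibbsLaw σ (fun _ => 1) (fun _ => 0) (fun _ => 1) N Φ) := by
  set LG := localGibbsLaw σ (fun _ => 1) (fun _ => 0) (fun _ => 1) N Φ with hLG
  haveI : IsProbabilityMeasure LG :=
    isProbabilityMeasure_localGibbsLaw continuous_const continuous_const continuous_const
      (fun _ => one_pos) (fun _ => one_pos) hσ N Φ
  have hψ' : ∀ s, 0 ≤ -deriv ψ s := fun s => neg_nonneg.2 hanti.deriv_nonpos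
  -- the jointly measurable integrand through the modification
  set H : Config (N + 1) (Fin 3) T3 × ℝ → ℝ≥0∞ :=
    fun p => ENNReal.ofReal (-deriv ψ p.2 * Dev r (flowReg Φ p)) with hH
  have hHm : Measurable H :=
    ((hψc.measurable.comp measurable_snd).neg.mul
      ((continuous_Dev r).measurable.comp (measurable_flowReg Φ))).ennreal_ofReal
  have hgood : ∀ᵐ z ∂LG, z ∈ Φ.good :=
    (withDensity_absolutelyContinuous (μ := liouville (Torus.geometry (Fin 3)) (N + 1)
      (hsDiameter σ N)) _).ae_le Φ.ae_mem_good
  -- step 1: the inner time integral as a lintegral of H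
  have h1 : ∀ᵐ z ∂LG, ENNReal.ofReal (∫ s in Set.Icc (0 : ℝ) 1, -deriv ψ s * Dev r (Φ.flow s z)) =
      ∫⁻ s in Set.Icc (0 : ℝ) 1, H (z, s) := by
    filter_upwards [hgood] with z hz
    rw [ofReal_integral_eq_lintegral_ofReal (integrableOn_weight_Dev hr hr2 Φ hψc hz)
      (ae_of_all _ fun s => mul_nonneg (hψ' s) (Dev_nonneg _ _))]
    refine lintegral_congr fun s => ?_
    simp only [hH, flowReg_of_mem Φ hz s]
  rw [lintegral_congr_ae h1]
  -- step 2: Tonelli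
  have hHae : AEMeasurable (Function.uncurry fun (z : Config (N + 1) (Fin 3) T3) (s : ℝ) => H (z, s))
      (LG.prod ((volume : Measure ℝ).restrict (Set.Icc (0 : ℝ) 1))) := hHm.aemeasurable
  rw [lintegral_lintegral_swap hHae]
  -- step 3: at fixed s, back to the flow and invariance
  have h3 : ∀ s, ∫⁻ z, H (z, s) ∂LG = ENNReal.ofReal (-deriv ψ s) * ∫⁻ w, ENNReal.ofReal (Dev r w) ∂LG := by
    intro s
    have hae : (fun z => H (z, s)) =ᵐ[LG] fun z => ENNReal.ofReal (-deriv ψ s) *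
        ENNReal.ofReal (Dev r (Φ.flow s z)) := by
      filter_upwards [hgood] with z hz
      simp only [hH, flowReg_of_mem Φ hz s]
      rw [ENNReal.ofReal_mul (hψ' s)]
    have hmz : Measurable fun z : Config (N + 1) (Fin 3) T3 => ENNReal.ofReal (Dev r (Φ.flow s z)) :=
      ((continuous_Dev r).measurable.comp (Φ.measurable_flow s)).ennreal_ofReal
    rw [lintegral_congr_ae hae, lintegral_const_mul (ENNReal.ofReal (-deriv ψ s)) hmz]
    congr 1
    exact Summit.AtomisticToContinuum.HydrodynamicLimit.Theorems.lintegral_comp_flow_localGibbsLaw_const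
      σ 1 1 0 N Φ s ((continuous_Dev r).measurable.ennreal_ofReal)
  simp_rw [h3]
  have hms : Measurable fun s : ℝ => ENNReal.ofReal (-deriv ψ s) := hψc.measurable.neg.ennreal_ofReal
  rw [lintegral_mul_const _ hms]
  congr 1
  have hint : IntegrableOn (fun s : ℝ => -deriv ψ s) (Set.Icc (0 : ℝ) 1) := (hψc.neg).integrableOn_Icc
  rw [← ofReal_integral_eq_lintegral_ofReal hint (ae_of_all _ hψ'),
    integral_Icc_eq_integral_Ioc, ← intervalIntegral.integral_of_le zero_le_one,
    intervalIntegral.integral_neg,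
    intervalIntegral.integral_deriv_eq_sub (fun x _ => hψd x) (hψc.intervalIntegrable _ _)]
  ring_nf


end Summit.AtomisticToContinuum.HydrodynamicLimit.Theorems.LocalSecondLawNegative

end
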